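import Literature.Computability.AlgebraicComplexity.GateQuotients
import HarnessLib

/-!
# The stages of the Valiant–Skyum–Berkowitz–Rackoff evaluation (algebraic part)

Trunk T-CPLX-ALG. Towards the named fact (B3) `Literature.Computability.AlgebraicComplexity.booleanPart_VP_NC_two_of_finite`
(Bürgisser 2000 TCS, Thm. 1.1(2): `BP(VP_k) ⊆ FNC²/poly` over a finite field, via Thm. 2.5 =
Valiant–Skyum–Berkowitz–Rackoff 1983: "`f` can be computed by a straight-line program of size
`O(d⁶ L(f)³)` and depth `O(log(d L(f)) log d + log n)`").

For a homogeneous circuit certificate `H` (`GateQuotients.lean`: nodes `ν` with formal degrees,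
values `[ν]` and gate quotients `[ν : μ]`, the frontier identities `val_eq_sum_frontier`,
`quot_eq_sum_frontier`) and a ring homomorphism `φ` out of the polynomial ring (evaluation at an
input point), this file defines the **tables of the `i`-th parallel stage** (`tables H φ i`):
stage `i` knows `φ[ν]` for all nodes of formal degree `≤ 2ⁱ` and `φ[ν : μ]` for all pairs with
`deg μ ≥ 2` and `deg ν − deg μ ≤ 2ⁱ`; stage `i + 1` obtains the values of degree `≤ 2ⁱ⁺¹` by
`[ν] = Σ_{w ∈ F_{2ⁱ}} [ν : w] · [w₁] · [w₂]` and then the quotients of difference `≤ 2ⁱ⁺¹` by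
`[ν : μ] = Σ_{w ∈ F_m} [ν : w] · [light w] · [heavy w : μ]`, `m = deg μ + 2ⁱ − 1`, each entry being a
sum of triple products of KNOWN entries (`tables_succ_fst`, `tables_succ_snd`); the invariant is
`tables_eq` (VSBR 1983; Bürgisser 2000 TCS, proof of Thm. 2.5). Entries outside the known range
are `0` (values) or frozen (quotients). Stage `0` consists of the values of degree `≤ 1` and the
quotients of difference `≤ 1` (`quotTable₀`: constants, resp. one frontier identity over
constants and degree-`1` values; `quotTable₀_eq`). After `⌈log₂ d⌉` stages every value of formal
degree `≤ d` is known (`tables_fst_eq_of_clog`). The terms with a vanishing true factor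
(`[ν : w] = 0` for `deg w > deg ν`, `[heavy w : μ] = 0` for `deg heavy w < deg μ`) are the only ones
whose partner entries may lie outside the known range, which makes the invariant go through. The
Boolean circuits realising the stages over a finite field (one-hot codes, balanced trees of
addition gadgets of depth `O(log #nodes)` per stage) are assembled in the sequel.

## References

* L. G. Valiant, S. Skyum, S. Berkowitz, C. Rackoff, *Fast parallel computation of polynomials
  using few processors*, SIAM J. Comput. 12 (1983) 641–644.
* P. Bürgisser, *Cook's versus Valiant's hypothesis*, Theoret. Comput. Sci. 235 (2000), Thm. 2.5
  (p. 77) and §5 (B) (p. 87).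
* S. Tavenas, *Improved bounds for reduction to depth 4 and depth 3*, Inform. Comput. 240 (2015),
  §5 (gate quotients, frontier identities) — as formalised in `GateQuotients.lean`.
-/

noncomputable section

namespace Literature.Computability.AlgebraicComplexity.DepthReduction

namespace HomCircuit

open MvPolynomial Finset

universe u v w

variable {k : Type u} {σ : Type v} {ι : Type w} [CommSemiring k]
variable (H : HomCircuit k σ ι) [DecidableEq ι] [Fintype ι]
variable {A : Type*} [CommSemiring A] (φ : MvPolynomial σ k →+* A)

/-! ### The stage tables -/

/-- The quotients of degree difference `≤ 1` (stage `0`): difference `0`: the (constant)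
quotient itself; difference `1`, `deg μ ≥ 2`: the frontier identity at `m = deg μ`, a sum of
triple products of constants and values of degree `≤ 1`; otherwise `0`. [cite: ValiantSkyumBerkowitzRackoff1983] -/
def quotTable₀ (ν μ : ι) : A :=
  if H.deg ν - H.deg μ = 0 then φ (H.quot ν μ)
  else if H.deg ν - H.deg μ = 1 then
    ∑ w ∈ H.frontier (H.deg μ),
      φ (H.quot ν w) * ((if H.deg (H.light (H.children w).1 (H.children w).2) ≤ 1 then
        φ (H.val (H.light (H.children w).1 (H.children w).2)) else 0) *
        φ (H.quot (H.heavy (H.children w).1 (H.children w).2) μ))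
  else 0

/-- **The tables of stage `i`**: (values of the nodes of formal degree `≤ 2ⁱ`, `0` elsewhere;
quotients of the pairs of degree difference `≤ 2ⁱ`). Stage `i + 1` computes the values of degree
in `(2ⁱ, 2ⁱ⁺¹]` by `[ν] = Σ_{w ∈ F_{2ⁱ}} [ν : w] · [w₁] · [w₂]` from stage `i`, then the quotients of
difference in `(2ⁱ, 2ⁱ⁺¹]` by `[ν : μ] = Σ_{w ∈ F_m} [ν : w] · [light w] · [heavy w : μ]`,
`m = deg μ + 2ⁱ − 1`, from stage `i` and the new values. [cite: ValiantSkyumBerkowitzRackoff1983] [cite: Burgisser2000TCS, Thm. 2.5 p. 77] -/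
def tables : ℕ → (ι → A) × (ι → ι → A)
  | 0 => (fun ν => if H.deg ν ≤ 1 then φ (H.val ν) else 0, H.quotTable₀ φ)
  | i + 1 =>
    let V := (tables i).1
    let Q := (tables i).2
    let V' : ι → A := fun ν => if H.deg ν ≤ 2 ^ i then V ν else
      ∑ w ∈ H.frontier (2 ^ i), Q ν w * (V (H.children w).1 * V (H.children w).2)
    (V', fun ν μ => if H.deg ν - H.deg μ ≤ 2 ^ i then Q ν μ else
      ∑ w ∈ H.frontier (H.deg μ + 2 ^ i - 1),
        Q ν w * (V' (H.light (H.children w).1 (H.children w).2) *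
          Q (H.heavy (H.children w).1 (H.children w).2) μ))

/-- The value table of stage `i + 1`, unfolded. [folklore] -/
theorem tables_succ_fst (i : ℕ) (ν : ι) :
    (H.tables φ (i + 1)).1 ν = if H.deg ν ≤ 2 ^ i then (H.tables φ i).1 ν else
      ∑ w ∈ H.frontier (2 ^ i), (H.tables φ i).2 ν w *
        ((H.tables φ i).1 (H.children w).1 * (H.tables φ i).1 (H.children w).2) := rfl

/-- The quotient table of stage `i + 1`, unfolded. [folklore] -/
theorem tables_succ_snd (i : ℕ) (ν μ : ι) :
    (H.tables φ (i + 1)).2 ν μ = if H.deg ν - H.deg μ ≤ 2 ^ i then (H.tables φ i).2 ν μ else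
      ∑ w ∈ H.frontier (H.deg μ + 2 ^ i - 1), (H.tables φ i).2 ν w *
        ((H.tables φ (i + 1)).1 (H.light (H.children w).1 (H.children w).2) *
          (H.tables φ i).2 (H.heavy (H.children w).1 (H.children w).2) μ) := rfl

/-! ### The frontier identities through `φ` -/

omit [DecidableEq ι] [Fintype ι] in
/-- A frontier node's value is the product of its children's values. [cite: ValiantSkyumBerkowitzRackoff1983] -/
theorem val_children [Fintype ι] [DecidableEq ι] {m : ℕ} {w : ι} (hw : w ∈ H.frontier m) :
    H.val w = H.val (H.children w).1 * H.val (H.children w).2 :=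
  (H.wf_prod w _ _ (H.of_mem_frontier hw).1).2.2.2

/-- **Correctness of the quotient base** (stage `0`): for `deg μ ≥ 2` and `deg ν − deg μ ≤ 1`,
`quotTable₀ ν μ = φ[ν : μ]`. [cite: ValiantSkyumBerkowitzRackoff1983] -/
theorem quotTable₀_eq {ν μ : ι} (hμ : 2 ≤ H.deg μ) (hδ : H.deg ν - H.deg μ ≤ 1) :
    H.quotTable₀ φ ν μ = φ (H.quot ν μ) := by
  unfold quotTable₀
  by_cases h0 : H.deg ν - H.deg μ = 0
  · rw [if_pos h0]
  have h1 : H.deg ν - H.deg μ = 1 := by omega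
  rw [if_neg h0, if_pos h1]
  have hm : 1 ≤ H.deg μ := by omega
  have hdeg : H.deg μ < H.deg ν := by omega
  rw [H.quot_eq_sum_frontier hm le_rfl hdeg, map_sum]
  refine Finset.sum_congr rfl fun w hw => ?_
  obtain ⟨hkind, hwm, h1m, h2m⟩ := H.of_mem_frontier hw
  rw [map_mul]
  by_cases hwν : H.deg ν < H.deg w
  · rw [H.quot_eq_zero_of_deg_lt' hwν, map_zero, zero_mul, zero_mul]
  have hne : w ≠ μ := fun h => by subst h; exact lt_irrefl _ hwm
  rw [H.quot_prod hkind hne, map_mul]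
  by_cases hh : H.deg (H.heavy (H.children w).1 (H.children w).2) < H.deg μ
  · simp only [H.quot_eq_zero_of_deg_lt' hh, map_zero, mul_zero]
  have hlight : H.deg (H.light (H.children w).1 (H.children w).2) ≤ 1 := by
    have hsum := H.deg_prod_eq hkind
    have hheavy := H.deg_heavy_le_of h1m h2m
    omega
  rw [if_pos hlight]

/-- **The invariant of the stages** (VSBR): at stage `i`, the value table is correct on the nodes
of formal degree `≤ 2ⁱ`, and the quotient table is correct on the pairs `(ν, μ)` with
`deg μ ≥ 2` and `deg ν − deg μ ≤ 2ⁱ`. [cite: ValiantSkyumBerkowitzRackoff1983] [cite: Burgisser2000TCS, Thm. 2.5 p. 77] -/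
theorem tables_eq : ∀ i : ℕ,
    (∀ ν, H.deg ν ≤ 2 ^ i → (H.tables φ i).1 ν = φ (H.val ν)) ∧
      ∀ ν μ, 2 ≤ H.deg μ → H.deg ν - H.deg μ ≤ 2 ^ i → (H.tables φ i).2 ν μ = φ (H.quot ν μ)
  | 0 => by
    refine ⟨fun ν hν => ?_, fun ν μ hμ hδ => ?_⟩
    · show (if H.deg ν ≤ 1 then φ (H.val ν) else 0) = _
      rw [if_pos (by simpa using hν)]
    · exact H.quotTable₀_eq φ hμ (by simpa using hδ)
  | i + 1 => by
    obtain ⟨ihV, ihQ⟩ := tables_eq i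
    have hm : 1 ≤ 2 ^ i := Nat.one_le_two_pow
    -- values
    have hV : ∀ ν, H.deg ν ≤ 2 ^ (i + 1) → (H.tables φ (i + 1)).1 ν = φ (H.val ν) := by
      intro ν hν
      rw [tables_succ_fst]
      by_cases hle : H.deg ν ≤ 2 ^ i
      · rw [if_pos hle, ihV ν hle]
      rw [if_neg hle, H.val_eq_sum_frontier hm (lt_of_not_ge hle), map_sum]
      refine Finset.sum_congr rfl fun w hw => ?_
      obtain ⟨hkind, hwm, h1m, h2m⟩ := H.of_mem_frontier hw
      rw [map_mul, H.val_children hw, map_mul, ihV _ h1m, ihV _ h2m, ihQ ν w (by omega) ?_]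
      rw [pow_succ] at hν
      omega
    refine ⟨hV, fun ν μ hμ hδ => ?_⟩
    rw [tables_succ_snd]
    by_cases hle : H.deg ν - H.deg μ ≤ 2 ^ i
    · rw [if_pos hle, ihQ ν μ hμ hle]
    rw [if_neg hle]
    set m := H.deg μ + 2 ^ i - 1 with hmdef
    have hm1 : 1 ≤ m := by omega
    have hμm : H.deg μ ≤ m := by omega
    have hmν : m < H.deg ν := by omega
    rw [H.quot_eq_sum_frontier hm1 hμm hmν, map_sum]
    refine Finset.sum_congr rfl fun w hw => ?_
    obtain ⟨hkind, hwm, h1m, h2m⟩ := H.of_mem_frontier hw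
    rw [map_mul]
    -- the first factor is known (difference `≤ 2^i`)
    rw [ihQ ν w (by omega) (by omega)]
    by_cases hwν : H.deg ν < H.deg w
    · rw [H.quot_eq_zero_of_deg_lt' hwν, map_zero, zero_mul, zero_mul]
    have hne : w ≠ μ := fun h => by subst h; exact lt_irrefl _ (lt_of_le_of_lt hμm hwm)
    rw [H.quot_prod hkind hne, map_mul]
    have hheavy := H.deg_heavy_le_of h1m h2m
    rw [ihQ _ μ hμ (by omega)]
    by_cases hh : H.deg (H.heavy (H.children w).1 (H.children w).2) < H.deg μ
    · simp only [H.quot_eq_zero_of_deg_lt' hh, map_zero, mul_zero]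
    rw [hV]
    have hsum := H.deg_prod_eq hkind
    rw [pow_succ] at hδ ⊢
    omega

/-- The values are all known after `⌈log₂ (deg ν)⌉` stages. [cite: ValiantSkyumBerkowitzRackoff1983] -/
theorem tables_fst_eq_of_clog {i : ℕ} {ν : ι} (h : Nat.clog 2 (H.deg ν) ≤ i) :
    (H.tables φ i).1 ν = φ (H.val ν) :=
  (H.tables_eq φ i).1 ν ((Nat.clog_le_iff_le_pow one_lt_two).1 h)

end HomCircuit

end Literature.Computability.AlgebraicComplexity.DepthReduction
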